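import Mathlib
import Summits.KontsevichZagierPeriods.KontsevichZagierPeriods.Theorems.IsogenyCertificatesRichelotChainCerts
import Summits.KontsevichZagierPeriods.KontsevichZagierPeriods.Theorems.IsogenyCertificatesRichelotChainCorr

/-!
# `RichelotChain` (stmt-KontsevichZagierPeriods-6732): the interval `(9, 10) ↔ (6, 13)`

Second bounded root intervals of `Ĉ : w² = F̂(z) = (z+15)(z−9)(z−10)(z−34)(z−36)(z−60)` and
`C : y² = F(x) = x(x−6)(x−13)(x−30)(x−40)(x−45)` (`F̂ > 0`, `F > 0` there: real ovals):
`[(9,10), (α+βz)/√|F̂|] ~ [(6,13), ½(α+βx)/√|F|]`. Here the SOURCE is the `C`-side: the two real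
sheets of `Z₁ : Φ⁰(x,z) = 0` over `x ∈ (6,10)` and `x ∈ (10,13)` are the larger `z`-root of
`Φ⁰(x,·)` (the smaller lies below `−15`), each mapping onto `(9,10)`, and the trace of `dx/y` over
the two `x`-roots is `2·dz/w` (`cert0_trace_z`, the dual Richelot isogeny is `[2]` on
differentials), whence the factor `½`. Interval-specific sign bookkeeping:
`disc_z Φ⁰ = 8x(170−11x)(650−23x)(45−x)`, `disc_x Φ⁰ = −25(z+18)(z−10)(z−34)(23z−1530)`,
`Φ⁰(x,9) = 675(x−6)(x−13)`, `Φ⁰(x,10) = 650(x−10)²`, `Φ⁰(x,−19) = 2187x² − 44465x + 234650 > 0`,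
`Φ⁰(x,−15) = 1875(x−6)(x−13)`, `Φ⁰(6,z) = 416(z+15)(z−9)`, `Φ⁰(z,z) = z(z−45)(z−10)(z−34)`,
`Φ⁰(10,z) = 300(z+18)(z−10)`, `Φ⁰(13,z) = 234(z+15)(z−9)`.

References: J.-B. Bost, J.-F. Mestre, Gaz. Math. 38 (1988), §2; M. Kontsevich, D. Zagier, *Periods*
(2001), §1.2.
-/

noncomputable section

open Set MeasureTheory
open Literature.NumberTheory.Transcendental Literature.ModelTheory.ExponentialFields

namespace Summit.KontsevichZagierPeriods.IsogenyCertificates.RichelotChain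

/-- **`RichelotChain`, interval `k = 1`:** `[(9,10), (α+βz)/√|F̂|] ~ [(6,13), ½(α+βx)/√|F|]`.
[cite: BostMestre1988, §2] -/
theorem sheet_k1 (α β : ℚ) (r r' : KZ.IntegralRep 1)
    (h1 : r.domain = {z | (9 : ℝ) < z 0 ∧ z 0 < 10})
    (h2 : EqOn r.integrand (fun z => ((α : ℝ) + (β : ℝ) * z 0) /
      Real.sqrt |(z 0 + 15) * (z 0 - 9) * (z 0 - 10) * (z 0 - 34) * (z 0 - 36) * (z 0 - 60)|) r.domain)
    (h3 : r'.domain = {x | (6 : ℝ) < x 0 ∧ x 0 < 13})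
    (h4 : EqOn r'.integrand (fun x => (1 / 2 : ℝ) * ((α : ℝ) + (β : ℝ) * x 0) /
      Real.sqrt |x 0 * (x 0 - 6) * (x 0 - 13) * (x 0 - 30) * (x 0 - 40) * (x 0 - 45)|) r'.domain) :
    KZ.Equivalent r r' := by
  -- the data of the correspondence `Z₁`, in the `z`-root direction (source variable `t = x`,
  -- target variable `y = z`): `Φ⁰(x = t, z = y) = a(t)y² + b(t)y + c(t) = P(y)t² + Q(y)t + R(y)`
  set a : ℝ → ℝ := fun t => t ^ 2 - 45 * t + 650 with ha_def
  set b : ℝ → ℝ := fun t => -44 * t ^ 2 + 680 * t with hb_def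
  set c : ℝ → ℝ := fun t => 990 * t ^ 2 - 15300 * t with hc_def
  set a₁ : ℝ → ℝ := fun t => 2 * t - 45 with ha₁_def
  set b₁ : ℝ → ℝ := fun t => -88 * t + 680 with hb₁_def
  set c₁ : ℝ → ℝ := fun t => 1980 * t - 15300 with hc₁_def
  set P : ℝ → ℝ := fun y => y ^ 2 - 44 * y + 990 with hP_def
  set Q : ℝ → ℝ := fun y => -45 * y ^ 2 + 680 * y - 15300 with hQ_def
  set R : ℝ → ℝ := fun y => 650 * y ^ 2 with hR_def
  set Ft : ℝ → ℝ := fun y => (y + 15) * (y - 9) * (y - 10) * (y - 34) * (y - 36) * (y - 60) with hFt_def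
  set Fs : ℝ → ℝ := fun t => t * (t - 6) * (t - 13) * (t - 30) * (t - 40) * (t - 45) with hFs_def
  set Ψ : ℝ → ℝ → ℝ := fun y t => 25 * (t - 6) * (t - 13) * (y - 36) * (y - 60) * (t - y) with hΨ_def
  have defs : (∀ t, a t = t ^ 2 - 45 * t + 650) ∧ (∀ t, b t = -44 * t ^ 2 + 680 * t) ∧
      (∀ t, c t = 990 * t ^ 2 - 15300 * t) ∧ (∀ t, a₁ t = 2 * t - 45) ∧ (∀ t, b₁ t = -88 * t + 680) ∧
      (∀ t, c₁ t = 1980 * t - 15300) ∧ (∀ y, P y = y ^ 2 - 44 * y + 990) ∧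
      (∀ y, Q y = -45 * y ^ 2 + 680 * y - 15300) ∧ (∀ y, R y = 650 * y ^ 2) ∧
      (∀ y, Ft y = (y + 15) * (y - 9) * (y - 10) * (y - 34) * (y - 36) * (y - 60)) ∧
      (∀ t, Fs t = t * (t - 6) * (t - 13) * (t - 30) * (t - 40) * (t - 45)) ∧
      (∀ y t, Ψ y t = 25 * (t - 6) * (t - 13) * (y - 36) * (y - 60) * (t - y)) :=
    ⟨fun _ => rfl, fun _ => rfl, fun _ => rfl, fun _ => rfl, fun _ => rfl, fun _ => rfl, fun _ => rfl,
      fun _ => rfl, fun _ => rfl, fun _ => rfl, fun _ => rfl, fun _ _ => rfl⟩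
  obtain ⟨ea, eb, ec, ea₁, eb₁, ec₁, eP, eQ, eR, eFt, eFs, eΨ⟩ := defs
  -- hypotheses of `correspondence_transfer`
  have hexp : ∀ y t : ℝ, a t * y ^ 2 + b t * y + c t = P y * t ^ 2 + Q y * t + R y := by
    intro y t; rw [ea, eb, ec, eP, eQ, eR]; ring
  have hda : ∀ t, HasDerivAt a (a₁ t) t := fun t =>
    (hasDerivAt_quad 1 (-45) 650 t (fun u => by rw [ea]; ring)).congr_deriv (by rw [ea₁]; ring)
  have hdb : ∀ t, HasDerivAt b (b₁ t) t := fun t =>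
    (hasDerivAt_quad (-44) 680 0 t (fun u => by rw [eb]; ring)).congr_deriv (by rw [eb₁]; ring)
  have hdc : ∀ t, HasDerivAt c (c₁ t) t := fun t =>
    (hasDerivAt_quad 990 (-15300) 0 t (fun u => by rw [ec]; ring)).congr_deriv (by rw [ec₁]; ring)
  have hsa : ∀ σ : Set (Fin 1 → ℝ), IsSemialgebraic ℚ σ → IsSemialgebraicFunOn ℚ σ (fun p => a (p 0)) :=
    fun σ hσ => poly_semialgebraic hσ (MvPolynomial.X 0 ^ 2 - 45 * MvPolynomial.X 0 + 650) a
      (fun x => by rw [ea]; simp)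
  have hsb : ∀ σ : Set (Fin 1 → ℝ), IsSemialgebraic ℚ σ → IsSemialgebraicFunOn ℚ σ (fun p => b (p 0)) :=
    fun σ hσ => poly_semialgebraic hσ (-44 * MvPolynomial.X 0 ^ 2 + 680 * MvPolynomial.X 0) b
      (fun x => by rw [eb]; simp)
  have hsc : ∀ σ : Set (Fin 1 → ℝ), IsSemialgebraic ℚ σ → IsSemialgebraicFunOn ℚ σ (fun p => c (p 0)) :=
    fun σ hσ => poly_semialgebraic hσ (990 * MvPolynomial.X 0 ^ 2 - 15300 * MvPolynomial.X 0) c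
      (fun x => by rw [ec]; simp)
  have hsa₁ : ∀ σ : Set (Fin 1 → ℝ), IsSemialgebraic ℚ σ → IsSemialgebraicFunOn ℚ σ (fun p => a₁ (p 0)) :=
    fun σ hσ => poly_semialgebraic hσ (2 * MvPolynomial.X 0 - 45) a₁ (fun x => by rw [ea₁]; simp)
  have hsb₁ : ∀ σ : Set (Fin 1 → ℝ), IsSemialgebraic ℚ σ → IsSemialgebraicFunOn ℚ σ (fun p => b₁ (p 0)) :=
    fun σ hσ => poly_semialgebraic hσ (-88 * MvPolynomial.X 0 + 680) b₁ (fun x => by rw [eb₁]; simp)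
  have hsc₁ : ∀ σ : Set (Fin 1 → ℝ), IsSemialgebraic ℚ σ → IsSemialgebraicFunOn ℚ σ (fun p => c₁ (p 0)) :=
    fun σ hσ => poly_semialgebraic hσ (1980 * MvPolynomial.X 0 - 15300) c₁ (fun x => by rw [ec₁]; simp)
  have hΦP : ∀ y t : ℝ, a t * y ^ 2 + b t * y + c t = 0 →
      (t ^ 2 - 45 * t + 650) * y ^ 2 + (-44 * t ^ 2 + 680 * t) * y + (990 * t ^ 2 - 15300 * t) = 0 := by
    intro y t h; rw [ea, eb, ec] at h; linear_combination h
  have hnorm : ∀ y t : ℝ, a t * y ^ 2 + b t * y + c t = 0 → Ft y * Fs t = Ψ y t ^ 2 := by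
    intro y t h
    have c0 := cert0_norm t y
    rw [hΦP y t h, zero_mul, sub_eq_zero] at c0
    rw [eFt, eFs, eΨ]
    linear_combination c0
  have hcert : ∀ y t : ℝ, a t * y ^ 2 + b t * y + c t = 0 →
      Ft y * (2 * a t * y + b t) + 2 * (P y * (y + t) + Q y) * Ψ y t = 0 := by
    intro y t h
    have c0 := cert0_trace_z t y
    rw [hΦP y t h, zero_mul] at c0
    rw [eFt, ea, eb, eP, eQ, eΨ]
    linear_combination c0
  have ha : ∀ t : ℝ, ((6 : ℚ) : ℝ) < t → t < ((13 : ℚ) : ℝ) → 0 < a t := by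
    intro t _ _; rw [ea]; nlinarith [sq_nonneg (2 * t - 45)]
  have hd : ∀ t : ℝ, ((6 : ℚ) : ℝ) < t → t < ((13 : ℚ) : ℝ) → t ≠ ((10 : ℚ) : ℝ) →
      0 < b t ^ 2 - 4 * a t * c t := by
    intro t h1 h2 _
    push_cast at h1 h2
    rw [ea, eb, ec, show (-44 * t ^ 2 + 680 * t) ^ 2 - 4 * (t ^ 2 - 45 * t + 650) * (990 * t ^ 2 - 15300 * t) =
      8 * t * (170 - 11 * t) * (650 - 23 * t) * (45 - t) by ring]
    exact mul_pos (mul_pos (mul_pos (mul_pos (by norm_num) (by linarith)) (by linarith)) (by linarith))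
      (by linarith)
  -- the quadratic in `z` over a point `t = x` of the source: continuity and values at 9, 10, −19, −15
  have hcx : ∀ t : ℝ, Continuous (fun y : ℝ => a t * y ^ 2 + b t * y + c t) := by
    intro t; rw [ea, eb, ec]; fun_prop
  have hv9 : ∀ t : ℝ, a t * (9 : ℝ) ^ 2 + b t * 9 + c t = 675 * (t - 6) * (t - 13) := by
    intro t; rw [ea, eb, ec]; ring
  have hv10 : ∀ t : ℝ, a t * (10 : ℝ) ^ 2 + b t * 10 + c t = 650 * (t - 10) ^ 2 := by
    intro t; rw [ea, eb, ec]; ring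
  have hv19 : ∀ t : ℝ, a t * (-19 : ℝ) ^ 2 + b t * (-19) + c t = 2187 * t ^ 2 - 44465 * t + 234650 := by
    intro t; rw [ea, eb, ec]; ring
  have hv15 : ∀ t : ℝ, a t * (-15 : ℝ) ^ 2 + b t * (-15) + c t = 1875 * (t - 6) * (t - 13) := by
    intro t; rw [ea, eb, ec]; ring
  have hyroots : ∀ t : ℝ, ((6 : ℚ) : ℝ) < t → t < ((13 : ℚ) : ℝ) → t ≠ ((10 : ℚ) : ℝ) →
      (∃ y : ℝ, ((9 : ℚ) : ℝ) < y ∧ y < ((10 : ℚ) : ℝ) ∧ a t * y ^ 2 + b t * y + c t = 0) ∧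
        ∃ y' : ℝ, ((-19 : ℚ) : ℝ) < y' ∧ y' < ((-15 : ℚ) : ℝ) ∧ a t * y' ^ 2 + b t * y' + c t = 0 := by
    intro t ht1 ht2 ht0
    push_cast at ht1 ht2 ht0 ⊢
    have hneg : (t - 6) * (t - 13) < 0 := mul_neg_of_pos_of_neg (by linarith) (by linarith)
    have hsq : 0 < (t - 10) ^ 2 := by
      have : t - 10 ≠ 0 := sub_ne_zero.mpr ht0
      positivity
    constructor
    · have h0 : (0 : ℝ) ∈ Ioo (a t * (9 : ℝ) ^ 2 + b t * 9 + c t) (a t * (10 : ℝ) ^ 2 + b t * 10 + c t) := by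
        rw [hv9, hv10]
        exact ⟨by nlinarith, by nlinarith⟩
      obtain ⟨y, hy, hy0⟩ := intermediate_value_Ioo (show (9 : ℝ) ≤ 10 by norm_num) (hcx t).continuousOn h0
      exact ⟨y, hy.1, hy.2, hy0⟩
    · have h0 : (0 : ℝ) ∈ Ioo (a t * (-15 : ℝ) ^ 2 + b t * (-15) + c t)
          (a t * (-19 : ℝ) ^ 2 + b t * (-19) + c t) := by
        rw [hv19, hv15]
        exact ⟨by nlinarith, by nlinarith [sq_nonneg (4374 * t - 44465)]⟩
      obtain ⟨y, hy, hy0⟩ := intermediate_value_Ioo' (show (-19 : ℝ) ≤ -15 by norm_num) (hcx t).continuousOn h0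
      exact ⟨y, hy.1, hy.2, hy0⟩
  have hsep : ∀ y y' : ℝ, ((9 : ℚ) : ℝ) < y → y < ((10 : ℚ) : ℝ) → ((-19 : ℚ) : ℝ) < y' → y' < ((-15 : ℚ) : ℝ) →
      0 < (((1 : ℚ)) : ℝ) * (y - y') := by
    intro y y' hy _ _ hy'
    push_cast at hy hy' ⊢
    nlinarith
  have hP : ∀ y : ℝ, ((9 : ℚ) : ℝ) < y → y < ((10 : ℚ) : ℝ) → P y ≠ 0 := by
    intro y _ _; rw [eP]; nlinarith [sq_nonneg (y - 22)]
  -- the quadratic in `t = x` over a point `y = z` of the target: continuity and values at 6, y, 10, 13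
  have hct : ∀ y : ℝ, Continuous (fun t : ℝ => a t * y ^ 2 + b t * y + c t) := by
    intro y; simp only [ea, eb, ec]; fun_prop
  have hw6 : ∀ y : ℝ, a 6 * y ^ 2 + b 6 * y + c 6 = 416 * (y + 15) * (y - 9) := by
    intro y; rw [ea, eb, ec]; ring
  have hwy : ∀ y : ℝ, a y * y ^ 2 + b y * y + c y = y * (y - 45) * (y - 10) * (y - 34) := by
    intro y; rw [ea, eb, ec]; ring
  have hw10 : ∀ y : ℝ, a 10 * y ^ 2 + b 10 * y + c 10 = 300 * (y + 18) * (y - 10) := by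
    intro y; rw [ea, eb, ec]; ring
  have hw13 : ∀ y : ℝ, a 13 * y ^ 2 + b 13 * y + c 13 = 234 * (y + 15) * (y - 9) := by
    intro y; rw [ea, eb, ec]; ring
  have htroots : ∀ y : ℝ, ((9 : ℚ) : ℝ) < y → y < ((10 : ℚ) : ℝ) →
      (∃ t : ℝ, ((6 : ℚ) : ℝ) < t ∧ t < ((10 : ℚ) : ℝ) ∧ t < y ∧ a t * y ^ 2 + b t * y + c t = 0) ∧
        ∃ t : ℝ, ((10 : ℚ) : ℝ) < t ∧ t < ((13 : ℚ) : ℝ) ∧ y < t ∧ a t * y ^ 2 + b t * y + c t = 0 := by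
    intro y hy1 hy2
    push_cast at hy1 hy2 ⊢
    have hpos : 0 < (y + 15) * (y - 9) := mul_pos (by linarith) (by linarith)
    constructor
    · -- a root in (6, y): Φ⁰(6,z) = 416(z+15)(z−9) > 0 > Φ⁰(z,z) = z(z−45)(z−10)(z−34)
      have h0 : (0 : ℝ) ∈ Ioo (a y * y ^ 2 + b y * y + c y) (a 6 * y ^ 2 + b 6 * y + c 6) := by
        rw [hwy, hw6]
        refine ⟨?_, by nlinarith⟩
        have h1 : 0 < y * (45 - y) := mul_pos (by linarith) (by linarith)
        have h2 : 0 < (10 - y) * (34 - y) := mul_pos (by linarith) (by linarith)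
        nlinarith [mul_pos h1 h2]
      obtain ⟨t, ht, ht0⟩ := intermediate_value_Ioo' (show (6 : ℝ) ≤ y by linarith) (hct y).continuousOn h0
      exact ⟨t, ht.1, by linarith [ht.2], ht.2, ht0⟩
    · -- a root in (10, 13): Φ⁰(10,z) = 300(z+18)(z−10) < 0 < Φ⁰(13,z) = 234(z+15)(z−9)
      have h0 : (0 : ℝ) ∈ Ioo (a 10 * y ^ 2 + b 10 * y + c 10) (a 13 * y ^ 2 + b 13 * y + c 13) := by
        rw [hw10, hw13]
        refine ⟨?_, by nlinarith⟩
        nlinarith [mul_pos (by linarith : (0 : ℝ) < y + 18) (by linarith : (0 : ℝ) < 10 - y)]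
      obtain ⟨t, ht, ht0⟩ := intermediate_value_Ioo (show (10 : ℝ) ≤ 13 by norm_num) (hct y).continuousOn h0
      exact ⟨t, ht.1, ht.2, by linarith [ht.1], ht0⟩
  have hDz : ∀ y : ℝ, ((9 : ℚ) : ℝ) < y → y < ((10 : ℚ) : ℝ) → Q y ^ 2 - 4 * P y * R y ≠ 0 := by
    intro y hy1 hy2
    push_cast at hy1 hy2
    rw [eP, eQ, eR, show (-45 * y ^ 2 + 680 * y - 15300) ^ 2 - 4 * (y ^ 2 - 44 * y + 990) * (650 * y ^ 2) =
      -25 * (y + 18) * (y - 10) * (y - 34) * (23 * y - 1530) by ring]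
    refine mul_ne_zero (mul_ne_zero (mul_ne_zero (mul_ne_zero (by norm_num) ?_) ?_) ?_) ?_
    · exact (by linarith : (0 : ℝ) < y + 18).ne'
    · exact (by linarith : y - 10 < 0).ne
    · exact (by linarith : y - 34 < 0).ne
    · exact (by linarith : 23 * y - 1530 < 0).ne
  have hFt : ∀ y : ℝ, ((9 : ℚ) : ℝ) < y → y < ((10 : ℚ) : ℝ) → Ft y ≠ 0 := by
    intro y hy1 hy2
    push_cast at hy1 hy2
    rw [eFt]
    refine mul_ne_zero (mul_ne_zero (mul_ne_zero (mul_ne_zero (mul_ne_zero ?_ ?_) ?_) ?_) ?_) ?_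
    · exact (by linarith : (0 : ℝ) < y + 15).ne'
    · exact (by linarith : (0 : ℝ) < y - 9).ne'
    · exact (by linarith : y - 10 < 0).ne
    · exact (by linarith : y - 34 < 0).ne
    · exact (by linarith : y - 36 < 0).ne
    · exact (by linarith : y - 60 < 0).ne
  have hFs : ∀ t : ℝ, ((6 : ℚ) : ℝ) < t → t < ((13 : ℚ) : ℝ) → t ≠ ((10 : ℚ) : ℝ) → Fs t ≠ 0 := by
    intro t ht1 ht2 _
    push_cast at ht1 ht2
    rw [eFs]
    refine mul_ne_zero (mul_ne_zero (mul_ne_zero (mul_ne_zero (mul_ne_zero ?_ ?_) ?_) ?_) ?_) ?_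
    · exact (by linarith : (0 : ℝ) < t).ne'
    · exact (by linarith : (0 : ℝ) < t - 6).ne'
    · exact (by linarith : t - 13 < 0).ne
    · exact (by linarith : t - 30 < 0).ne
    · exact (by linarith : t - 40 < 0).ne
    · exact (by linarith : t - 45 < 0).ne
  have hr : r'.domain = {p | ((6 : ℚ) : ℝ) < p 0 ∧ p 0 < ((13 : ℚ) : ℝ)} := by push_cast; exact h3
  have hs : r.domain = {p | ((9 : ℚ) : ℝ) < p 0 ∧ p 0 < ((10 : ℚ) : ℝ)} := by push_cast; exact h1
  have hg : EqOn r'.integrand (fun p => (1 / 2) * ((α : ℝ) + (β : ℝ) * p 0) / Real.sqrt |Fs (p 0)|) r'.domain := by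
    intro p hp; rw [h4 hp]
  have hf : EqOn r.integrand (fun p => 1 * ((α : ℝ) + (β : ℝ) * p 0) / Real.sqrt |Ft (p 0)|) r.domain := by
    intro p hp; rw [h2 hp]; beta_reduce; rw [eFt, one_mul]
  exact (correspondence_transfer a b c a₁ b₁ c₁ P Q R Ft Fs Ψ 2 1 (1 / 2) (α : ℝ) (β : ℝ) 1 6 10 13 9 10 (-19) (-15)
    r' r (Or.inr rfl) (by norm_num) (by norm_num) hexp hda hdb hdc hsa hsb hsc hsa₁ hsb₁ hsc₁ hnorm hcert
    (by norm_num) ha hd hyroots hsep hP htroots hDz hFt hFs hr hg hs hf).symm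

end Summit.KontsevichZagierPeriods.IsogenyCertificates.RichelotChain

end
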